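import Mathlib
import Summits.NavierStokesRegularity.NavierStokesRegularity.Theorems.TaoLadderRungThreeGappedFrontRobustActiveZone
import HarnessLib

/-!
# `GappedFrontRobust`, the (step) clause: THE ACTIVE ZONE with the defect budget INSIDE the bootstrap
  (helper for item stmt-NavierStokesRegularity-22114 `GappedFrontRobustV2`, K_B₂ assembly)

HONEST FRAMING: a theorem about Tao-type MODEL lattice pseudo-flows (Tao 2016 §4 Lemma 4.1 (4.8)) in the
cell vocabulary `TaoCascade.PseudoFlowOn`; a variant of the landed `pseudoFlowOn_active_zone'`
(`…ActiveZone`). Nothing here concerns the Navier–Stokes equations; nothing is asserted about any table.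

WHY THIS VARIANT. In the K_B₂ assembly the motion-defect budget
`∫₀ᵗ κ₁ (1+ε₀)^{2n} √F_{i,n} ≤ ψ₀ D n / 4` of the compared shells cannot be verified a priori with a margin
`η = κ₁` chosen before the pseudo-flow is given: `√F` is controlled only through the defect Grönwall bound
(`pseudoFlowOn_energy_le_exp`), which needs amplitude bounds, which exist only INSIDE the bootstrap (exact
envelope + weak deviation bounds). `pseudoFlowOn_active_zone''` therefore demands the defect budget at time
`t` — like the tail deviations — only as a CONSEQUENCE of the weak bounds of the compared shells on `[0, t]`.
The proof is the proof of `pseudoFlowOn_active_zone'` verbatim with the defect hypothesis invoked inside the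
improvement step.
-/

noncomputable section

-- the sub-problem namespace `Summit.NavierStokesRegularity.NavierStokesRegularity` repeats the summit name by design (D-0017)
set_option linter.dupNamespace false

namespace Summit.NavierStokesRegularity.NavierStokesRegularity.Theorems

open Set MeasureTheory intervalIntegral Literature.Analysis.FluidPDE Literature.Analysis.FluidPDE.TaoCascade

namespace GappedFrontRobust

variable {m : ℕ}
variable {τ ε₀ : ℝ} {α : Fin m → Fin m → Fin m → ℤ × ℤ × ℤ → ℝ} {κ₁ κ₂ κ₂' : ℝ}
  {S₀ F₀ B₀ F₀' B₀' : Fin m → ℤ → ℝ} {S F S' F' : Fin m → ℤ → ℝ → ℝ}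

/-- **THE ACTIVE ZONE, tail bounds AND defect budget as implications of the weak bounds.** As
`pseudoFlowOn_active_zone'`, but the defect budget `∫₀ᵗ κ₁ (1+ε₀)^{2n} √F_{i,n} ≤ ψ₀ D n / 4` (`n < k₂`) is
required at time `t` only under the weak deviation bounds
`|S − S'| ≤ 2 ψ₀ e^{4Γs} D` of the compared shells on `[0, t]`. Conclusion:
`|S_{i,n}(t) − S'_{i,n}(t)| ≤ ψ₀ e^{4Γt} D n` for every `n < k₂`, `t ∈ [0, τ]`.
[cite: Tao2016AveragedNS, §4 Lemma 4.1 (4.8) (continuous dependence of the cascade on its data, one clock window)] -/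
theorem pseudoFlowOn_active_zone'' (h : PseudoFlowOn τ ε₀ α κ₁ κ₂ S₀ F₀ B₀ S F)
    (h' : PseudoFlowOn τ ε₀ α 0 κ₂' S₀ F₀' B₀' S' F') (hτ : 0 < τ) (hε : 0 < 1 + ε₀)
    (k₂ : ℤ) {D A₀ : ℤ → ℝ} {Γ ψ₀ L : ℝ} (hΓ : 0 < Γ) (hψ₀ : 0 < ψ₀) (hL : 0 ≤ L)
    (hD0 : ∀ k, 0 ≤ D k)
    (hA₀ : ∀ u ∈ Icc 0 τ, ∀ (j : Fin m) (k : ℤ), |S' j k u| ≤ A₀ k)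
    (htail : ∀ t ∈ Icc 0 τ,
      (∀ s ∈ Icc 0 t, ∀ (j : Fin m) (k : ℤ), k < k₂ →
        |S j k s - S' j k s| ≤ 2 * (ψ₀ * Real.exp (4 * Γ * s)) * D k) →
      ∀ k : ℤ, k₂ ≤ k → ∀ u ∈ Icc 0 t, ∀ j : Fin m, |S j k u - S' j k u| ≤ ψ₀ * D k)
    (hrow : ∀ (i : Fin m) (n : ℤ), n < k₂ →
      ∑ i₁, ∑ i₂, ∑ μ ∈ shiftSet, |α i₁ i₂ i μ| * (1 + ε₀) ^ ((5 : ℝ) * (n - μ.2.2) / 2) *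
        (D (n - μ.2.2 + μ.1) * (A₀ (n - μ.2.2 + μ.2.1) + 2 * (ψ₀ * Real.exp (4 * Γ * τ)) *
            D (n - μ.2.2 + μ.2.1)) +
          (A₀ (n - μ.2.2 + μ.1) + 2 * (ψ₀ * Real.exp (4 * Γ * τ)) * D (n - μ.2.2 + μ.1)) *
            D (n - μ.2.2 + μ.2.1)) ≤ Γ * D n)
    (hdefect : ∀ t ∈ Icc 0 τ,
      (∀ s ∈ Icc 0 t, ∀ (j : Fin m) (k : ℤ), k < k₂ →
        |S j k s - S' j k s| ≤ 2 * (ψ₀ * Real.exp (4 * Γ * s)) * D k) →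
      ∀ (i : Fin m) (n : ℤ), n < k₂ →
        ∫ u in (0 : ℝ)..t, κ₁ * (1 + ε₀) ^ ((2 : ℝ) * n) * Real.sqrt (F i n u) ≤ ψ₀ * D n / 4)
    (hlip : ∀ (i : Fin m) (n : ℤ), n < k₂ → ∀ s ∈ Icc 0 τ, ∀ t ∈ Icc 0 τ,
      |(S i n t - S' i n t) - (S i n s - S' i n s)| ≤ L * D n * |t - s|) :
    ∀ (i : Fin m) (n : ℤ), n < k₂ → ∀ t ∈ Icc 0 τ,
      |S i n t - S' i n t| ≤ ψ₀ * Real.exp (4 * Γ * t) * D n := by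
  -- the profile
  set ψ : ℝ → ℝ := fun t => ψ₀ * Real.exp (4 * Γ * t) with hψ
  set ψmax : ℝ := ψ₀ * Real.exp (4 * Γ * τ) with hψmax
  have hψ_cont : ContinuousOn ψ (Icc 0 τ) :=
    (continuousOn_const.mul ((Real.continuous_exp.comp (continuous_const.mul continuous_id)).continuousOn))
  have hψpos : ∀ t ∈ Icc 0 τ, 0 < ψ t := fun t _ => mul_pos hψ₀ (Real.exp_pos _)
  have hψge : ∀ t ∈ Icc 0 τ, ψ₀ ≤ ψ t := fun t ht => by
    have : 1 ≤ Real.exp (4 * Γ * t) := Real.one_le_exp (by nlinarith [ht.1])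
    simp only [hψ]; nlinarith
  have hψle : ∀ t ∈ Icc 0 τ, ψ t ≤ ψmax := fun t ht => by
    simp only [hψ, hψmax]
    exact mul_le_mul_of_nonneg_left (Real.exp_le_exp.mpr (by nlinarith [ht.2])) hψ₀.le
  -- the family: deviations of the compared shells, zero elsewhere
  set u : Fin m × ℤ → ℝ → ℝ := fun j t => if j.2 < k₂ then |S j.1 j.2 t - S' j.1 j.2 t| else 0
    with hu
  set p : Fin m × ℤ → ℝ := fun j => D j.2 with hp
  have key := bootstrap_family (ι := Fin m × ℤ) (u := u) (p := p) (ψ := ψ) (τ := τ) (L := L)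
    (fun j => hD0 j.2) hL hψ_cont hψpos ?_ ?_ ?_
  · intro i n hn t ht
    have := key (i, n) t ht
    simpa [hu, hp, hn] using this
  · -- uniform Lipschitz
    rintro ⟨i, n⟩ s hs t ht
    by_cases hn : n < k₂
    · simp only [hu, hp, hn, if_true]
      exact (abs_abs_sub_abs_le_abs_sub _ _).trans (hlip i n hn s hs t ht)
    · simp only [hu, hp, hn, if_false, sub_self, abs_zero]
      exact mul_nonneg (mul_nonneg hL (hD0 n)) (abs_nonneg _)
  · -- start: same start state
    rintro ⟨i, n⟩
    by_cases hn : n < k₂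
    · simp only [hu, hp, hn, if_true, h.init_S, h'.init_S, sub_self, abs_zero]
      exact mul_nonneg (hψpos 0 ⟨le_rfl, hτ.le⟩).le (hD0 n)
    · simp only [hu, hp, hn, if_false]
      exact mul_nonneg (hψpos 0 ⟨le_rfl, hτ.le⟩).le (hD0 n)
  · -- the improvement step
    intro t ht hweak ⟨i, n⟩
    by_cases hn : n < k₂
    swap
    · simp only [hu, hp, hn, if_false]; exact mul_nonneg (hψpos t ht).le (hD0 n)
    simp only [hu, hp, hn, if_true]
    -- the weak bounds restated, and the tail bounds / defect budget they imply on [0, t]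
    have hweak' : ∀ s ∈ Icc 0 t, ∀ (j : Fin m) (k : ℤ), k < k₂ →
        |S j k s - S' j k s| ≤ 2 * (ψ₀ * Real.exp (4 * Γ * s)) * D k := by
      intro s hs j k hk
      have := hweak (j, k) s hs
      simp only [hu, hp, hk, if_true] at this
      exact this
    have htail' := htail t ht hweak'
    have hdef := hdefect t ht hweak' i n hn
    -- weak deviation bounds on ALL shells on [0, t], in the form D k · (2 ψ)
    have hDall : ∀ s ∈ Icc 0 t, ∀ (j : Fin m) (k : ℤ), |S j k s - S' j k s| ≤ D k * (2 * ψ s) := by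
      intro s hs j k
      have hsτ : s ∈ Icc 0 τ := ⟨hs.1, hs.2.trans ht.2⟩
      by_cases hk : k < k₂
      · have := hweak' s hs j k hk
        simp only [hψ]
        linarith
      · have h1 := htail' k (not_lt.mp hk) s hs j
        have h2 := hψge s hsτ
        have h3 := hD0 k
        nlinarith
    -- amplitude bounds with A := A₀ + 2 ψmax D
    have hA' : ∀ s ∈ Icc 0 t, ∀ (j : Fin m) (k : ℤ), |S' j k s| ≤ A₀ k + 2 * ψmax * D k := by
      intro s hs j k
      have h1 := hA₀ s ⟨hs.1, hs.2.trans ht.2⟩ j k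
      have : 0 ≤ 2 * ψmax * D k := by have := hD0 k; positivity
      linarith
    have hA : ∀ s ∈ Icc 0 t, ∀ (j : Fin m) (k : ℤ), |S j k s| ≤ A₀ k + 2 * ψmax * D k := by
      intro s hs j k
      have hsτ : s ∈ Icc 0 τ := ⟨hs.1, hs.2.trans ht.2⟩
      have h1 := hA₀ s hsτ j k
      have h2 := hDall s hs j k
      have h3 : D k * (2 * ψ s) ≤ 2 * ψmax * D k := by
        have := hψle s hsτ; have := hD0 k; nlinarith
      have h4 : |S j k s| ≤ |S' j k s| + |S j k s - S' j k s| := by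
        have := abs_add_le (S' j k s) (S j k s - S' j k s); simpa using this
      linarith
    have hdev := pseudoFlowOn_deviation_le h h' hτ hε ht (A := fun k => A₀ k + 2 * ψmax * D k)
      (D := D) (φ := fun s => 2 * ψ s) (continuousOn_const.mul hψ_cont) hA hA' hDall i n
    simp only [sub_self, abs_zero, zero_add] at hdev
    -- the profile integral: ∫₀ᵗ 2ψ ≤ ψ(t)/(2Γ)
    have hint : ∫ s in (0 : ℝ)..t, 2 * ψ s ≤ ψ t / (2 * Γ) := by
      have h1 := integral_exp_mul_le (t := t) (K := 4 * Γ) (ψ₀ := 2 * ψ₀) (by linarith) (by linarith)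
      have heq : (fun s => 2 * ψ s) = fun s => 2 * ψ₀ * Real.exp (4 * Γ * s) := by
        funext s; simp only [hψ]; ring
      rw [heq]
      refine h1.trans (le_of_eq ?_)
      simp only [hψ]; field_simp; ring
    have hR := hrow i n hn
    have hψt := hψpos t ht
    have hψt' := hψge t ht
    -- R · ∫ 2ψ ≤ Γ D n · ψ(t)/(2Γ) = ψ(t) D n / 2
    have hRint : (∑ i₁, ∑ i₂, ∑ μ ∈ shiftSet, |α i₁ i₂ i μ| * (1 + ε₀) ^ ((5 : ℝ) * (n - μ.2.2) / 2) *
        (D (n - μ.2.2 + μ.1) * (A₀ (n - μ.2.2 + μ.2.1) + 2 * ψmax * D (n - μ.2.2 + μ.2.1)) +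
          (A₀ (n - μ.2.2 + μ.1) + 2 * ψmax * D (n - μ.2.2 + μ.1)) * D (n - μ.2.2 + μ.2.1))) *
        (∫ s in (0 : ℝ)..t, 2 * ψ s) ≤ Γ * D n * (ψ t / (2 * Γ)) := by
      have hR0 : 0 ≤ ∑ i₁, ∑ i₂, ∑ μ ∈ shiftSet, |α i₁ i₂ i μ| *
          (1 + ε₀) ^ ((5 : ℝ) * (n - μ.2.2) / 2) *
          (D (n - μ.2.2 + μ.1) * (A₀ (n - μ.2.2 + μ.2.1) + 2 * ψmax * D (n - μ.2.2 + μ.2.1)) +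
            (A₀ (n - μ.2.2 + μ.1) + 2 * ψmax * D (n - μ.2.2 + μ.1)) * D (n - μ.2.2 + μ.2.1)) := by
        refine Finset.sum_nonneg fun i₁ _ => Finset.sum_nonneg fun i₂ _ =>
          Finset.sum_nonneg fun μ _ => ?_
        have hΛ : 0 ≤ (1 + ε₀) ^ ((5 : ℝ) * (n - μ.2.2) / 2) := (Real.rpow_pos_of_pos hε _).le
        have hAa : 0 ≤ A₀ (n - μ.2.2 + μ.1) + 2 * ψmax * D (n - μ.2.2 + μ.1) :=
          (abs_nonneg _).trans (hA' 0 ⟨le_rfl, ht.1⟩ i _)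
        have hAb : 0 ≤ A₀ (n - μ.2.2 + μ.2.1) + 2 * ψmax * D (n - μ.2.2 + μ.2.1) :=
          (abs_nonneg _).trans (hA' 0 ⟨le_rfl, ht.1⟩ i _)
        have := hD0 (n - μ.2.2 + μ.1); have := hD0 (n - μ.2.2 + μ.2.1)
        positivity
      have hI0 : 0 ≤ ∫ s in (0 : ℝ)..t, 2 * ψ s :=
        intervalIntegral.integral_nonneg ht.1 fun s hs =>
          mul_nonneg (by norm_num) (hψpos s ⟨hs.1, hs.2.trans ht.2⟩).le
      calc _ ≤ (Γ * D n) * (∫ s in (0 : ℝ)..t, 2 * ψ s) := mul_le_mul_of_nonneg_right hR hI0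
        _ ≤ Γ * D n * (ψ t / (2 * Γ)) :=
            mul_le_mul_of_nonneg_left hint (mul_nonneg hΓ.le (hD0 n))
    have hhalf : Γ * D n * (ψ t / (2 * Γ)) = ψ t * D n / 2 := by field_simp
    have hquarter : ψ₀ * D n / 4 ≤ ψ t * D n / 4 := by have := hD0 n; nlinarith
    calc |S i n t - S' i n t| ≤ Γ * D n * (ψ t / (2 * Γ)) + ψ₀ * D n / 4 := by linarith
      _ ≤ ψ t * D n / 2 + ψ t * D n / 4 := by rw [hhalf]; linarith
      _ ≤ ψ t * D n := by have := hD0 n; nlinarith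

end GappedFrontRobust

end Summit.NavierStokesRegularity.NavierStokesRegularity.Theorems

end
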